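import Summits.ValiantsHypothesis.ValiantsHypothesis.Theorems.SymPencilPerFourToricLever

/-!
# Route `SymPencil` — the toric case at dimension `6`, III: pair-space dimensions and the
# zero-row profile (`--supports` stmt-ValiantsHypothesis-5674 `SdcSuperquadratic`;
# crux workfile `Cruxes/SdcSuperquadratic/TORIC-SIX.md`)

Setting: `W` a `6`-dimensional space of `4 × 4` matrices with H3 (all `3 × 3` subpermanents
vanish) all of whose rows and columns have rank `≤ 2` (the TORIC case of the residual `R6`).

* `finrank_pair_le` / `finrank_single_le` — rank–nullity along two / three rows: the elements of
  `W` vanishing on rows `q, q'` (resp. `q, q', q''`) have dimension `≥ dim W - n_q - n_{q'}`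
  (resp. `- n_{q''}`).
* `false_of_zero_row` — **a toric `6`-dimensional singular subspace has no zero row.**  If row
  `q ≡ 0` then the three other rows split off as independent `2`-dimensional single-row spaces
  `L_a, L_b, L_c`; a column used by all three would have rank `3`, so (pigeonhole) some `L_r` is a
  coordinate plane `K^{k'l'}`; the pair lever (`SymPencilPerFourToricLever.pair_lever`) with
  `u = e_{k'}, e_{l'}` kills all `2 × 2` subpermanents of `L_{a'} ⊕ L_{b'}` off `{k', l'}`, whence
  `L_{a'} = L_{b'} = K^{k'l'}` (`subset_pair_of_bilinear_perm_orth`) and column `k'` has rank `3`.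

Honest framing: one profile of the toric case of `R6`; nothing here changes `sdc(per_4) ≥ 25`; the
crux `SdcSuperquadratic` and `VP ≠ VNP` are untouched.  No definitions, no named facts. [folklore]
-/

noncomputable section

-- single-conjunct layout: Sub = Summit, duplicated namespace component intended
set_option linter.dupNamespace false

namespace Summit.ValiantsHypothesis.ValiantsHypothesis.Theorems.SymPencilPerFourToricZeroRow

open Matrix Finset Module
open Literature.Computability.AlgebraicComplexity.AlperBogartVelasco
open Summit.ValiantsHypothesis.ValiantsHypothesis.Theorems.SymPencilPerFourHessianRankThreeZero
open Summit.ValiantsHypothesis.ValiantsHypothesis.Theorems.SymPencilPerFourHessianToric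
open Summit.ValiantsHypothesis.ValiantsHypothesis.Theorems.SymPencilPerFourBlockPerm
open Summit.ValiantsHypothesis.ValiantsHypothesis.Theorems.SymPencilPerFourToricLever

variable {K : Type*} [Field K]

/-! ### Rank–nullity along rows -/

/-- Membership in the pair space `W ⊓ ker ρ_q ⊓ ker ρ_{q'}`. [folklore] -/
theorem mem_pair_iff (W : Submodule K (Fin 4 × Fin 4 → K)) (q q' : Fin 4)
    (x : Fin 4 × Fin 4 → K) :
    x ∈ W ⊓ LinearMap.ker (LinearMap.funLeft K K fun j : Fin 4 => (q, j)) ⊓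
        LinearMap.ker (LinearMap.funLeft K K fun j : Fin 4 => (q', j)) ↔
      x ∈ W ∧ (∀ j, x (q, j) = 0) ∧ ∀ j, x (q', j) = 0 := by
  simp only [Submodule.mem_inf, LinearMap.mem_ker]
  constructor
  · rintro ⟨⟨hx, h1⟩, h2⟩
    exact ⟨hx, fun j => congr_fun h1 j, fun j => congr_fun h2 j⟩
  · rintro ⟨hx, h1, h2⟩
    exact ⟨⟨hx, funext h1⟩, funext h2⟩

/-- **Pair spaces are large**: `dim (W ∩ {rows q, q' = 0}) + n_q + n_{q'} ≥ dim W`. [folklore] -/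
theorem finrank_pair_le (W : Submodule K (Fin 4 × Fin 4 → K)) (q q' : Fin 4) :
    finrank K W ≤ finrank K ↥(W ⊓ LinearMap.ker (LinearMap.funLeft K K fun j : Fin 4 => (q, j)) ⊓
        LinearMap.ker (LinearMap.funLeft K K fun j : Fin 4 => (q', j))) +
      finrank K (W.map (LinearMap.funLeft K K fun j : Fin 4 => (q, j))) +
      finrank K (W.map (LinearMap.funLeft K K fun j : Fin 4 => (q', j))) := by
  set ρ := (LinearMap.funLeft K K fun j : Fin 4 => (q, j)) with hρ
  set ρ' := (LinearMap.funLeft K K fun j : Fin 4 => (q', j)) with hρ'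
  have h1 := finrank_eq_finrank_map_add_finrank_inf_ker W ρ
  have h2 := finrank_eq_finrank_map_add_finrank_inf_ker (W ⊓ LinearMap.ker ρ) ρ'
  have hmono : finrank K ((W ⊓ LinearMap.ker ρ).map ρ') ≤ finrank K (W.map ρ') :=
    Submodule.finrank_mono (Submodule.map_mono inf_le_left)
  omega

/-- **Single-row spaces**: `dim (W ∩ {rows q, q', q'' = 0}) + n_q + n_{q'} + n_{q''} ≥ dim W`.
[folklore] -/
theorem finrank_single_le (W : Submodule K (Fin 4 × Fin 4 → K)) (q q' q'' : Fin 4) :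
    finrank K W ≤ finrank K ↥(W ⊓ LinearMap.ker (LinearMap.funLeft K K fun j : Fin 4 => (q, j)) ⊓
        LinearMap.ker (LinearMap.funLeft K K fun j : Fin 4 => (q', j)) ⊓
        LinearMap.ker (LinearMap.funLeft K K fun j : Fin 4 => (q'', j))) +
      finrank K (W.map (LinearMap.funLeft K K fun j : Fin 4 => (q, j))) +
      finrank K (W.map (LinearMap.funLeft K K fun j : Fin 4 => (q', j))) +
      finrank K (W.map (LinearMap.funLeft K K fun j : Fin 4 => (q'', j))) := by
  set ρ'' := (LinearMap.funLeft K K fun j : Fin 4 => (q'', j)) with hρ''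
  set W₂ := W ⊓ LinearMap.ker (LinearMap.funLeft K K fun j : Fin 4 => (q, j)) ⊓
        LinearMap.ker (LinearMap.funLeft K K fun j : Fin 4 => (q', j)) with hW₂
  have h1 := finrank_pair_le W q q'
  have h2 := finrank_eq_finrank_map_add_finrank_inf_ker W₂ ρ''
  have hmono : finrank K (W₂.map ρ'') ≤ finrank K (W.map ρ'') :=
    Submodule.finrank_mono (Submodule.map_mono (inf_le_left.trans inf_le_left))
  rw [← hW₂] at h1
  omega

/-! ### The zero-row profile -/

set_option maxHeartbeats 800000 in
/-- **A toric `6`-dimensional singular subspace has no zero row.**  See the module docstring.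
[folklore] -/
theorem false_of_zero_row [CharZero K] (W : Submodule K (Fin 4 × Fin 4 → K))
    (hW3 : ∀ x ∈ W, ∀ (r c : Fin 3 → Fin 4), Function.Injective r → Function.Injective c →
      ((Matrix.of fun i j => x (i, j)).submatrix r c).permanent = 0)
    (hrow : ∀ r : Fin 4, finrank K (W.map (LinearMap.funLeft K K fun j : Fin 4 => (r, j))) ≤ 2)
    (hcol : ∀ l : Fin 4, finrank K (W.map (LinearMap.funLeft K K fun i : Fin 4 => (i, l))) ≤ 2)
    (h6 : finrank K W = 6) (q : Fin 4) (hq : ∀ x ∈ W, ∀ j, x (q, j) = 0) : False := by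
  classical
  -- notation
  let ρ : Fin 4 → (Fin 4 × Fin 4 → K) →ₗ[K] (Fin 4 → K) :=
    fun r => LinearMap.funLeft K K fun j : Fin 4 => (r, j)
  have hρ : ∀ r x j, ρ r x j = x (r, j) := fun _ _ _ => rfl
  let γ : Fin 4 → (Fin 4 × Fin 4 → K) →ₗ[K] (Fin 4 → K) :=
    fun l => LinearMap.funLeft K K fun i : Fin 4 => (i, l)
  have hγ : ∀ l x i, γ l x i = x (i, l) := fun _ _ _ => rfl
  have hrow' : ∀ r, finrank K (W.map (ρ r)) ≤ 2 := hrow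
  have hcol' : ∀ l, finrank K (W.map (γ l)) ≤ 2 := hcol
  -- (A) single-row elements realise every row value, and every row `≠ q` has rank `2`
  have hA : ∀ p a b : Fin 4, p ≠ q → a ≠ q → b ≠ q → p ≠ a → p ≠ b → a ≠ b →
      finrank K (W.map (ρ p)) = 2 ∧
      ∀ x ∈ W, ∃ z ∈ W, (∀ i j, i ≠ p → z (i, j) = 0) ∧ ∀ j, z (p, j) = x (p, j) := by
    intro p a b hpq haq hbq hpa hpb hab
    set T := W ⊓ LinearMap.ker (ρ q) ⊓ LinearMap.ker (ρ a) ⊓ LinearMap.ker (ρ b) with hT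
    have memT : ∀ z, z ∈ T ↔ z ∈ W ∧ (∀ j, z (q, j) = 0) ∧ (∀ j, z (a, j) = 0) ∧
        ∀ j, z (b, j) = 0 := by
      intro z
      rw [hT, Submodule.mem_inf, mem_pair_iff, LinearMap.mem_ker]
      exact ⟨fun h => ⟨h.1.1, h.1.2.1, h.1.2.2, fun j => congr_fun h.2 j⟩,
        fun h => ⟨⟨h.1, h.2.1, h.2.2.1⟩, funext h.2.2.2⟩⟩
    have hdim : finrank K W ≤ finrank K T + finrank K (W.map (ρ q)) + finrank K (W.map (ρ a)) +
        finrank K (W.map (ρ b)) := finrank_single_le W q a b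
    have hq0 : finrank K (W.map (ρ q)) = 0 := by
      rw [Submodule.finrank_eq_zero, Submodule.eq_bot_iff]
      rintro _ ⟨x, hx, rfl⟩
      funext j; exact hq x hx j
    have hTge : 2 ≤ finrank K T := by
      have := hrow' a; have := hrow' b; omega
    -- `ρ p` is injective on `T`
    have hsingle : ∀ z ∈ T, ∀ i j, i ≠ p → z (i, j) = 0 := by
      intro z hz i j hip
      obtain ⟨-, hzq, hza, hzb⟩ := (memT z).1 hz
      rcases eq_or_of_four q a b p haq.symm hbq.symm hpq.symm hab hpa.symm hpb.symm i with
        hi | hi | hi | hi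
      · rw [hi]; exact hzq j
      · rw [hi]; exact hza j
      · rw [hi]; exact hzb j
      · exact absurd hi hip
    have hinj : Function.Injective ((ρ p).domRestrict T) := by
      intro z₁ z₂ h
      apply Subtype.ext
      funext c; obtain ⟨i, j⟩ := c
      have hsub : ((z₁ : Fin 4 × Fin 4 → K) - z₂) ∈ T := T.sub_mem z₁.2 z₂.2
      by_cases hip : i = p
      · have := congr_fun h j
        simp only [LinearMap.domRestrict_apply, hρ] at this
        rw [hip]; exact this
      · exact sub_eq_zero.1 (by have := hsingle _ hsub i j hip; rwa [Pi.sub_apply] at this)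
    have hTmap : finrank K (T.map (ρ p)) = finrank K T := by
      rw [← LinearMap.range_domRestrict]; exact LinearMap.finrank_range_of_inj hinj
    have hle : T.map (ρ p) ≤ W.map (ρ p) :=
      Submodule.map_mono (inf_le_left.trans (inf_le_left.trans inf_le_left))
    have hp2 : finrank K (W.map (ρ p)) = 2 := by
      have := Submodule.finrank_mono hle; have := hrow' p; omega
    have heq : T.map (ρ p) = W.map (ρ p) :=
      Submodule.eq_of_le_of_finrank_le hle (by rw [hTmap, hp2]; exact hTge)
    refine ⟨hp2, fun x hx => ?_⟩
    have : ρ p x ∈ T.map (ρ p) := by rw [heq]; exact ⟨x, hx, rfl⟩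
    obtain ⟨z, hzT, hzx⟩ := this
    exact ⟨z, (inf_le_left.trans (inf_le_left.trans inf_le_left) : T ≤ W) hzT,
      hsingle z hzT, fun j => by have := congr_fun hzx j; rwa [hρ] at this⟩
  -- the three other rows
  obtain ⟨a, b, c, hab, hac, hbc, haq, hbq, hcq, hrows⟩ := exists_three_others q
  -- (B1) a live cell `(p, j)` puts `e_p` in the column space `C_j`
  have hB1 : ∀ p j, p ≠ q → (∃ x ∈ W, x (p, j) ≠ 0) →
      (Pi.single p (1 : K) : Fin 4 → K) ∈ W.map (γ j) := by
    rintro p j hpq ⟨x, hx, hxj⟩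
    obtain ⟨r', r'', hr'r'', hr'q, hr'p, hr''q, hr''p, -⟩ := exists_other_two q p (Ne.symm hpq)
    obtain ⟨-, hz⟩ := hA p r' r'' hpq hr'q hr''q (Ne.symm hr'p) (Ne.symm hr''p) hr'r''
    obtain ⟨z, hzW, hzs, hzp⟩ := hz x hx
    refine ⟨(x (p, j))⁻¹ • z, W.smul_mem _ hzW, funext fun i => ?_⟩
    rw [map_smul, Pi.smul_apply, hγ, smul_eq_mul]
    by_cases hip : i = p
    · rw [hip, hzp, inv_mul_cancel₀ hxj, Pi.single_eq_same]
    · rw [hzs i j hip, mul_zero, Pi.single_eq_of_ne hip]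
  -- (B2) no column is live in all three rows `a, b, c`
  have hB2 : ∀ j, (∃ x ∈ W, x (a, j) ≠ 0) → (∃ x ∈ W, x (b, j) ≠ 0) →
      (∃ x ∈ W, x (c, j) ≠ 0) → False := by
    intro j ha hb hc
    have hli : LinearIndependent K (⇑(Pi.basisFun K (Fin 4)) ∘ ![a, b, c]) :=
      (Pi.basisFun K (Fin 4)).linearIndependent.comp _
        (by intro i i' h; fin_cases i <;> fin_cases i' <;> simp_all [eq_comm])
    have hspan : Submodule.span K (Set.range (⇑(Pi.basisFun K (Fin 4)) ∘ ![a, b, c])) ≤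
        W.map (γ j) := by
      rw [Submodule.span_le]
      rintro _ ⟨i, rfl⟩
      fin_cases i
      · simpa using hB1 a j haq ha
      · simpa using hB1 b j hbq hb
      · simpa using hB1 c j hcq hc
    have h3 : finrank K (Submodule.span K (Set.range (⇑(Pi.basisFun K (Fin 4)) ∘ ![a, b, c])))
        = 3 := by rw [finrank_span_eq_card hli, Fintype.card_fin]
    have := Submodule.finrank_mono hspan
    have := hcol' j
    omega
  -- (B3) a row `≠ q` has at most two dead cells, and two dead cells make it a coordinate plane
  have hB3 : ∀ p, p ≠ q → ∀ k l m : Fin 4, k ≠ l → k ≠ m → l ≠ m →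
      (∀ x ∈ W, x (p, k) = 0) → (∀ x ∈ W, x (p, l) = 0) → ∃ x ∈ W, x (p, m) ≠ 0 := by
    intro p hpq k l m hkl hkm hlm hk hl
    by_contra hm
    push Not at hm
    obtain ⟨n, hnk, hnl, hnm, hcols⟩ := eq_or_of_three_cols k l m hkl hkm hlm
    obtain ⟨r', r'', hr'r'', hr'q, hr'p, hr''q, hr''p, -⟩ := exists_other_two q p (Ne.symm hpq)
    obtain ⟨hp2, -⟩ := hA p r' r'' hpq hr'q hr''q (Ne.symm hr'p) (Ne.symm hr''p) hr'r''
    -- `ρ p (W) ⊆ K e_n`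
    have hle : W.map (ρ p) ≤ Submodule.span K {(Pi.single n (1 : K) : Fin 4 → K)} := by
      rintro _ ⟨x, hx, rfl⟩
      rw [Submodule.mem_span_singleton]
      refine ⟨x (p, n), funext fun j => ?_⟩
      rw [Pi.smul_apply, hρ, smul_eq_mul]
      rcases hcols j with hj | hj | hj | hj <;> rw [hj]
      · rw [hk x hx, Pi.single_eq_of_ne (Ne.symm hnk), mul_zero]
      · rw [hl x hx, Pi.single_eq_of_ne (Ne.symm hnl), mul_zero]
      · rw [hm x hx, Pi.single_eq_of_ne (Ne.symm hnm), mul_zero]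
      · rw [Pi.single_eq_same, mul_one]
    have h1 := (Submodule.finrank_mono hle).trans (finrank_span_le_card ({(Pi.single n (1 : K) : Fin 4 → K)} : Set (Fin 4 → K)))
    simp at h1
    omega
  -- (C) pigeonhole: some row `r ≠ q` has two dead cells
  obtain ⟨r, hrq, k, l, hkl, hk, hl⟩ : ∃ r, r ≠ q ∧ ∃ k l : Fin 4, k ≠ l ∧
      (∀ x ∈ W, x (r, k) = 0) ∧ ∀ x ∈ W, x (r, l) = 0 := by
    by_contra H
    push Not at H
    -- every column has a dead row among `a, b, c`
    have hdead : ∀ j, ∃ i : Fin 3, ∀ x ∈ W, x (![a, b, c] i, j) = 0 := by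
      intro j
      by_contra h
      push Not at h
      obtain ⟨xa, hxa, hxa'⟩ := h 0
      obtain ⟨xb, hxb, hxb'⟩ := h 1
      obtain ⟨xc, hxc, hxc'⟩ := h 2
      exact hB2 j ⟨xa, hxa, by simpa using hxa'⟩ ⟨xb, hxb, by simpa using hxb'⟩
        ⟨xc, hxc, by simpa using hxc'⟩
    choose f hf using hdead
    obtain ⟨j, j', hjj', hfj⟩ := Fintype.exists_ne_map_eq_of_card_lt f (by simp)
    have hne : (![a, b, c] (f j) : Fin 4) ≠ q := by
      have : ∀ i : Fin 3, (![a, b, c] i : Fin 4) ≠ q := by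
        intro i; fin_cases i
        · simpa using haq
        · simpa using hbq
        · simpa using hcq
      exact this _
    obtain ⟨x, hx, hxl⟩ := H _ hne j j' hjj' (hf j)
    exact hxl (by rw [hfj]; exact hf j' x hx)
  -- the two live columns `k', l'` of row `r`, and the two other rows `a', b'`
  obtain ⟨k', l', hk'l', hk'k, hk'l, hl'k, hl'l, hcols⟩ := exists_other_two k l hkl
  obtain ⟨a', b', ha'b', ha'q, ha'r, hb'q, hb'r, hrows'⟩ := exists_other_two q r hrq.symm
  -- row `r` realises `e_{k'}` and `e_{l'}` by single-row elements
  have hLr : ∀ v : Fin 4 → K, v k = 0 → v l = 0 →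
      ∃ z ∈ W, (∀ i j, i ≠ r → z (i, j) = 0) ∧ ∀ j, z (r, j) = v j := by
    intro v hvk hvl
    obtain ⟨hr2, hz⟩ := hA r a' b' hrq ha'q hb'q (Ne.symm ha'r) (Ne.symm hb'r) ha'b'
    have hle : ∀ x ∈ W.map (ρ r), ∀ m, m ≠ k' → m ≠ l' → x m = 0 := by
      rintro _ ⟨x, hx, rfl⟩ m hmk' hml'
      rw [hρ]
      rcases hcols m with hm | hm | hm | hm
      · rw [hm]; exact hk x hx
      · rw [hm]; exact hl x hx
      · exact absurd hm hmk'
      · exact absurd hm hml'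
    have hv : v ∈ W.map (ρ r) :=
      mem_of_le_pair_of_finrank _ k' l' hle (by rw [hr2]) v (fun m hmk' hml' => by
        rcases hcols m with hm | hm | hm | hm
        · rw [hm]; exact hvk
        · rw [hm]; exact hvl
        · exact absurd hm hmk'
        · exact absurd hm hml')
    obtain ⟨x, hx, hxv⟩ := hv
    obtain ⟨z, hzW, hzs, hzr⟩ := hz x hx
    exact ⟨z, hzW, hzs, fun j => by rw [hzr, ← hρ r x j, hxv]⟩
  obtain ⟨zk, hzk, hzks, hzkr⟩ := hLr (Pi.single k' 1) (Pi.single_eq_of_ne (Ne.symm hk'k) _)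
    (Pi.single_eq_of_ne (Ne.symm hk'l) _)
  obtain ⟨zl, hzl, hzls, hzlr⟩ := hLr (Pi.single l' 1) (Pi.single_eq_of_ne (Ne.symm hl'k) _)
    (Pi.single_eq_of_ne (Ne.symm hl'l) _)
  -- the pair lever: all `2 × 2` subpermanents of rows `a', b'` off `{k', l'}` vanish on the
  -- elements of `W` with rows `q, r` zero
  have hlev : ∀ x ∈ W, (∀ j, x (r, j) = 0) → ∀ m m' : Fin 4, m ≠ m' → ¬(m = k' ∧ m' = l') →
      ¬(m = l' ∧ m' = k') → x (a', m) * x (b', m') + x (a', m') * x (b', m) = 0 := by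
    intro x hx hxr
    refine perms_vanish_of_lever_pair x a' b' k' l' hk'l' fun u hu j₀ j₁ j₂ h01 h02 h12 => ?_
    rcases hu with hu | hu
    · have e := pair_lever W hW3 hx hzk ha'b' ha'r hb'r hxr h01 h02 h12
      rw [hzkr, hzkr, hzkr] at e; rw [hu]; exact e
    · have e := pair_lever W hW3 hx hzl ha'b' ha'r hb'r hxr h01 h02 h12
      rw [hzlr, hzlr, hzlr] at e; rw [hu]; exact e
  -- hence `L_{a'} ⊥ L_{b'}` off `{k', l'}` (bilinearly, through single-row elements)
  have hbil : ∀ v ∈ W.map (ρ a'), ∀ v' ∈ W.map (ρ b'), ∀ m m' : Fin 4, m ≠ m' →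
      ¬(m = k' ∧ m' = l') → ¬(m = l' ∧ m' = k') → v m * v' m' + v m' * v' m = 0 := by
    rintro _ ⟨x, hx, rfl⟩ _ ⟨x', hx', rfl⟩ m m' hmm' h1 h2
    obtain ⟨z, hzW, hzs, hzr⟩ := (hA a' b' r ha'q hb'q hrq ha'b' ha'r hb'r).2 x hx
    obtain ⟨z', hz'W, hz's, hz'r⟩ := (hA b' a' r hb'q ha'q hrq ha'b'.symm hb'r ha'r).2 x' hx'
    have hsum : z + z' ∈ W := W.add_mem hzW hz'W
    have e := hlev (z + z') hsum (fun j => by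
      rw [Pi.add_apply, hzs r j (Ne.symm ha'r), hz's r j (Ne.symm hb'r), add_zero]) m m' hmm' h1 h2
    simp only [Pi.add_apply, hzs b' _ ha'b'.symm, hz's a' _ ha'b', add_zero, zero_add, hzr,
      hz'r] at e
    rw [hρ, hρ, hρ, hρ]
    exact e
  have ha2 := (hA a' b' r ha'q hb'q hrq ha'b' ha'r hb'r).1
  have hb2 := (hA b' a' r hb'q ha'q hrq ha'b'.symm hb'r ha'r).1
  -- so `a'` and `b'` are dead at `k` (a column outside `{k', l'}`)
  have hka' : ∀ x ∈ W, x (a', k) = 0 := fun x hx =>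
    subset_pair_of_bilinear_perm_orth (W.map (ρ a')) (W.map (ρ b')) k' l' hbil (by rw [hb2])
      (ρ a' x) ⟨x, hx, rfl⟩ k hk'k.symm hl'k.symm
  have hkb' : ∀ x ∈ W, x (b', k) = 0 := fun x hx =>
    subset_pair_of_bilinear_perm_orth (W.map (ρ b')) (W.map (ρ a')) k' l'
      (fun v hv v' hv' m m' hmm' h1 h2 => by
        have := hbil v' hv' v hv m m' hmm' h1 h2; linear_combination this) (by rw [ha2])
      (ρ b' x) ⟨x, hx, rfl⟩ k hk'k.symm hl'k.symm
  have hla' : ∀ x ∈ W, x (a', l) = 0 := fun x hx =>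
    subset_pair_of_bilinear_perm_orth (W.map (ρ a')) (W.map (ρ b')) k' l' hbil (by rw [hb2])
      (ρ a' x) ⟨x, hx, rfl⟩ l hk'l.symm hl'l.symm
  have hlb' : ∀ x ∈ W, x (b', l) = 0 := fun x hx =>
    subset_pair_of_bilinear_perm_orth (W.map (ρ b')) (W.map (ρ a')) k' l'
      (fun v hv v' hv' m m' hmm' h1 h2 => by
        have := hbil v' hv' v hv m m' hmm' h1 h2; linear_combination this) (by rw [ha2])
      (ρ b' x) ⟨x, hx, rfl⟩ l hk'l.symm hl'l.symm
  -- all three rows `a', b', r` are live at `k'`: column `k'` has rank `3`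
  have la := hB3 a' ha'q k l k' hkl hk'k.symm hk'l.symm hka' hla'
  have lb := hB3 b' hb'q k l k' hkl hk'k.symm hk'l.symm hkb' hlb'
  have lr := hB3 r hrq k l k' hkl hk'k.symm hk'l.symm hk hl
  have key : ∀ p, p ≠ q → ∃ x ∈ W, x (p, k') ≠ 0 := by
    intro p hpq
    rcases hrows' p with hp | hp | hp | hp
    · exact absurd hp hpq
    · rw [hp]; exact lr
    · rw [hp]; exact la
    · rw [hp]; exact lb
  exact hB2 k' (key a haq) (key b hbq) (key c hcq)

end Summit.ValiantsHypothesis.ValiantsHypothesis.Theorems.SymPencilPerFourToricZeroRow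

end
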